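import Literature.Geometry.ComplexAnalytic.RelativeExponentialUniformisation        -- ★ P-1 (U6-a): the printed fact `relativeExponentialUniformisation` + prefix currency
import Literature.Geometry.ComplexAnalytic.RelativeExponentialFlowChart             -- ★ p849129 (FILE 3): `exists_isRelExpChartOn_of_relExpFlow` ((L1) p849017 + (L2) p849083 + (L3))
import Literature.Geometry.ComplexAnalytic.RelativeExponentialChartFibreGroupLaw     -- ★ p849209 (O4): `exists_additive_isAnalytification_fibre_of_isRelExpChartOn`
import Literature.NumberTheory.Transcendental.AnalytificationSeparatedProofs         -- ★ `t2Space_algPoints_holds`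
import Literature.AlgebraicGeometry.Motives.AlgPointsProperMapProofs                 -- ★ `AlgPoints.isProperMap_map`
import HarnessLib

/-!
# The relative exponential uniformisation of an abelian scheme FROM a relative exponential flow

[DeligneHodgeII1971] P. Deligne, *Théorie de Hodge II*, Publ. Math. IHÉS 40 (1971), §4.4 (4.4.2)–(4.4.3) p. 50: for an abelian
scheme `f : A → S` over a smooth complex base, the relative Lie algebra exponential `exp : Lie(A/S) → A^an` is, locally on
`S^an`, a surjective étale homomorphism of commutative relative complex Lie groups whose kernel is a local system of lattices
— the relative uniformisation `A^an|_U ≅ (U × ℂ^g) / Λ`.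
[BirkenhakeLange2004] C. Birkenhake, H. Lange, *Complex Abelian Varieties* (2nd ed.), Springer Grundlehren 302 (2004), §1.1
Lemma 1.1.1 (p. 8), §1.2 Prop. 1.2.1 (p. 10), Ch. 8 §8.7: the one-torus statements (kernel of the exponential is a lattice;
holomorphic maps of tori fixing `0` are homomorphisms) and holomorphic families of period matrices.
[MumfordAV1970] D. Mumford, *Abelian Varieties*, Oxford U.P. (1970), §1 (1)–(2): a complex abelian variety is a compact
connected complex Lie group, hence a complex torus `ℂ^g / Λ` via the exponential.
[SerreGAGA1956] J.-P. Serre, *Géométrie algébrique et géométrie analytique*, Ann. Inst. Fourier 6 (1956), §2 n°5 p. 9: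
analytification of proper ∕ separated morphisms (compact fibres, Hausdorff total space).

## What this file proves (sorry-free, generic)

The printed fact ★ `Literature.Geometry.ComplexAnalytic.relativeExponentialUniformisation` (P-1 of the Hodge programme's
crux `hLiu418`, file `RelativeExponentialUniformisation.lean` :282) asks, for every datum `(S, d, A, g, MS, φS, hS, MA, φA, hφA)`
and every `m : MS`, for an open `U ∋ m`, a period family `Φ` and a map `ex` forming an ★ `IsRelExpChartOn` over the analytic
projection `basePoint hS A φA`, whose fibre maps are ADDITIVE ANALYTIFICATIONS of the algebraic fibres.

`relativeExponentialUniformisation_of_exists_relExpFlow` REDUCES it to the bare existence of a RELATIVE EXPONENTIAL FLOW near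
every point — an open `U ∋ m` and a map `ex : MS × ℂ^g → MA`, `C^ω` on `U × ℂ^g`, lying over `basePoint`, normalised at the
identity section, with bijective complex differential, satisfying the translation law `ex (u, z) = ex (u, z') ↔ ex (u, z' - z) =
ex (u, 0)` and onto every fibre over `U` (the seven hypotheses of the head, unbundled, in the token shape of the road-B
theorem `exists_relExpFlow`; this is [DeligneHodgeII1971] (4.4.2) minus every lattice statement).  Everything else is now in the tree:
* the fibrewise stabilisers are full lattices and vary holomorphically, giving the chart — ★ `exists_isRelExpChartOn_of_relExpFlow`
  (`RelativeExponentialFlowChart.lean`; kernel lattice ★ `exists_frame_kernel_of_relExpFlow`, holomorphic periods ★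
  `exists_holomorphic_periods_of_relExpFlow`, étale field ★ `exists_localInverse_of_bijective_mfderiv`), fed with the two
  bricks proved here from the prefix: `MA` is Hausdorff (`A → S → Spec ℂ` separated, ★ `t2Space_algPoints_holds`) and the
  fibres of `basePoint` are compact (`A(ℂ) → S(ℂ)` proper, ★ `AlgPoints.isProperMap_map`);
* the fibre maps of a normalised chart are additive analytifications — ★ `exists_additive_isAnalytification_fibre_of_isRelExpChartOn`
  (`RelativeExponentialChartFibreGroupLaw.lean`; torus rigidity ★ `ComplexTorus.exists_addHomeomorph_of_bijective_mdifferentiable`).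

The remaining input — the flow itself — is the road-B theorem `exists_relExpFlow` (fibre uniformisation ★
`exists_fibre_uniformisation_immersion`, doubling-equivariant germ, fibrewise Kœnigs linearisation ★ `KoenigsLinearization`,
equivariant extension ★ `DoublingChartExtension.exists_equivariant_extension`, additivity ★
`ComplexTorusDoublingEquivariantLift.exists_linear_of_doubling_equivariant`); once it lands,
`relativeExponentialUniformisation` itself is the one-line application of this file's head to it.

Theorems only; no `def`, `structure`, `instance` or notation.
-/

set_option autoImplicit false

open scoped Manifold ContDiff Topology
open Set Function CategoryTheory AlgebraicGeometry
open Literature.Geometry.Kaehler (ComplexTorus)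
open Literature.Geometry.Kaehler.ComplexTorus (cover)
open Literature.NumberTheory.Transcendental (IsAnalytification)
open Literature.AlgebraicGeometry.Motives (SchemeOver AlgPoints ComplexPoints)
open Literature.AlgebraicGeometry.AbelianSchemes (AbelianSchemeOver)

namespace Literature.Geometry.ComplexAnalytic

section Bricks

variable {S : SchemeOver ℂ} {d : ℕ} (A : AbelianSchemeOver S.left) {g : ℕ}
  {MS : Type} [TopologicalSpace MS] [ChartedSpace (Fin d → ℂ) MS]
  {φS : MS → ComplexPoints S} (hS : IsAnalytification (Fin d → ℂ) S d φS)
  {MA : Type} [TopologicalSpace MA] [ChartedSpace (Fin (d + g) → ℂ) MA]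
  {φA : MA → ComplexPoints (totalOver S A)}
  (hφA : IsAnalytification (Fin (d + g) → ℂ) (totalOver S A) (d + g) φA)

include hφA in
/-- **The analytic total space is Hausdorff.**  `A → S → Spec ℂ` is separated (`A → S` proper, `S` separated), so `A(ℂ)`
is `T₂` (★ `t2Space_algPoints_holds`) and the analytification `φA` is a homeomorphism onto it.
[cite: SerreGAGA1956, §2 n°5 p. 9] [cite: MumfordFogartyKirwan1994, Ch. 0 §4] -/
theorem t2Space_of_isAnalytification_totalOver [IsSeparated S.hom] : T2Space MA := by
  haveI := A.isProper
  haveI : IsSeparated (totalOver S A).hom := by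
    change IsSeparated (A.X.hom ≫ S.hom)
    infer_instance
  haveI : T2Space (ComplexPoints (totalOver S A)) :=
    Literature.NumberTheory.Transcendental.t2Space_algPoints_holds (totalOver S A) ℂ
  exact hφA.homeomorph.symm.t2Space

include hφA in
/-- **The fibres of the analytic projection are compact.**  `A(ℂ) → S(ℂ)` is a proper map of topological spaces
(`A → S` proper, ★ `AlgPoints.isProperMap_map`), read through the homeomorphisms `φA` and `φS`.
[cite: MumfordAV1970, §1 (1)–(2)] [cite: SerreGAGA1956, §2 n°5 p. 9] -/
theorem isCompact_preimage_basePoint_singleton (u : MS) : IsCompact ((basePoint hS A φA) ⁻¹' {u}) := by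
  haveI := A.isProper
  haveI : UniversallyClosed (projOver S A).left := by
    change UniversallyClosed A.X.hom
    infer_instance
  haveI : QuasiCompact (projOver S A).left := by
    change QuasiCompact A.X.hom
    infer_instance
  have hK : IsCompact ((AlgPoints.map (projOver S A)) ⁻¹' {hS.homeomorph u}) :=
    (AlgPoints.isProperMap_map (L := ℂ) (projOver S A)).isCompact_preimage isCompact_singleton
  have hset : (basePoint hS A φA) ⁻¹' {u} = φA ⁻¹' ((AlgPoints.map (projOver S A)) ⁻¹' {hS.homeomorph u}) := by
    ext a
    simp only [mem_preimage, mem_singleton_iff, basePoint, comp_apply]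
    constructor
    · intro h
      rw [← h, Homeomorph.apply_symm_apply]
    · intro h
      rw [h, Homeomorph.symm_apply_apply]
  rw [hset, ← IsAnalytification.coe_homeomorph hφA]
  exact hφA.homeomorph.isCompact_preimage.mpr hK

end Bricks

/-- **Relative exponential uniformisation FROM a relative exponential flow** ([DeligneHodgeII1971] (4.4.2)–(4.4.3)).
If near every point of the analytic base `MS` the abelian scheme `A → S` carries a relative exponential flow — an open `U ∋ m`
and `ex : MS × ℂ^g → MA`, `C^ω` on `U × ℂ^g`, over `basePoint`, normalised at the identity section, with bijective complex
differential, with the translation law of a `ℂ^g`-action and onto the fibres over `U` — then ★ `relativeExponentialUniformisation`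
holds: the flow restricted to a smaller open `V ∋ m` is an ★ `IsRelExpChartOn` with holomorphic periods
(★ `exists_isRelExpChartOn_of_relExpFlow`, using that `MA` is Hausdorff and the fibres are compact) whose fibre maps are additive
analytifications of the algebraic fibres (★ `exists_additive_isAnalytification_fibre_of_isRelExpChartOn`, using the
normalisation).  The hypothesis is stated over P-1's binder prefix verbatim.
[cite: DeligneHodgeII1971, §4.4 (4.4.2) p. 50] [cite: BirkenhakeLange2004, §1.1 Lemma 1.1.1 (p. 8); §1.2 Prop. 1.2.1 (p. 10); Ch. 8 §8.7] [cite: MumfordAV1970, §1 (1)–(2)] -/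
theorem relativeExponentialUniformisation_of_exists_relExpFlow
    (hflow : ∀ (S : SchemeOver ℂ) (d : ℕ) [LocallyOfFiniteType S.hom] [IsSeparated S.hom] [SmoothOfRelativeDimension d S.hom]
      (A : AbelianSchemeOver S.left) (g : ℕ) (_ : A.IsOfRelDim g)
      (MS : Type) [TopologicalSpace MS] [ChartedSpace (Fin d → ℂ) MS] [IsManifold 𝓘(ℂ, Fin d → ℂ) ω MS]
      (φS : MS → ComplexPoints S) (hS : IsAnalytification (Fin d → ℂ) S d φS)
      (MA : Type) [TopologicalSpace MA] [ChartedSpace (Fin (d + g) → ℂ) MA] [IsManifold 𝓘(ℂ, Fin (d + g) → ℂ) ω MA]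
      (φA : MA → ComplexPoints (totalOver S A)) (_ : IsAnalytification (Fin (d + g) → ℂ) (totalOver S A) (d + g) φA),
      ∀ m : MS, ∃ U : Set MS, m ∈ U ∧ ∃ ex : MS × (Fin g → ℂ) → MA,
        IsOpen U ∧
        ContMDiffOn (𝓘(ℂ, Fin d → ℂ).prod 𝓘(ℂ, Fin g → ℂ)) 𝓘(ℂ, Fin (d + g) → ℂ) ω ex (U ×ˢ (univ : Set (Fin g → ℂ))) ∧
        (∀ u ∈ U, ∀ z : Fin g → ℂ, basePoint hS A φA (ex (u, z)) = u) ∧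
        (∀ u ∈ U, (φA (ex (u, 0))).left = A.fibrePointToLeft (φS u).left 1) ∧
        (∀ q ∈ U ×ˢ (univ : Set (Fin g → ℂ)),
          Bijective (mfderiv (𝓘(ℂ, Fin d → ℂ).prod 𝓘(ℂ, Fin g → ℂ)) 𝓘(ℂ, Fin (d + g) → ℂ) ex q)) ∧
        (∀ u ∈ U, ∀ z z' : Fin g → ℂ, ex (u, z) = ex (u, z') ↔ ex (u, z' - z) = ex (u, 0)) ∧
        (∀ a : MA, basePoint hS A φA a ∈ U → ∃ z : Fin g → ℂ, ex (basePoint hS A φA a, z) = a)) :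
    relativeExponentialUniformisation := by
  intro S d _ _ _ A g hA MS _ _ _ φS hS MA _ _ _ φA hφA m
  obtain ⟨U, hmU, ex, hU, hex, hp, hzero, hbij, hsub, hsurj⟩ := hflow S d A g hA MS φS hS MA φA hφA m
  haveI : T2Space MA := t2Space_of_isAnalytification_totalOver A hφA
  have hι : Fintype.card (Fin g ⊕ Fin g) = 2 * Module.finrank ℂ (Fin g → ℂ) := by simp [two_mul]
  obtain ⟨V, hmV, hVU, Φ, hchart⟩ := exists_isRelExpChartOn_of_relExpFlow (ι := Fin g ⊕ Fin g) hU hex hp hbij hsub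
    hsurj hι (fun b _ => isCompact_preimage_basePoint_singleton A hS hφA b) hmU
  exact ⟨V, hmV, Φ, ex, hchart, exists_additive_isAnalytification_fibre_of_isRelExpChartOn S d A g hA MS φS hS MA φA
    hφA V Φ ex hchart fun u hu => hzero u (hVU hu)⟩

end Literature.Geometry.ComplexAnalytic
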